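import Mathlib
import HarnessLib
import Summits.HubbardSuperconductivity.HubbardSuperconductivity.Theorems.KLProgrammeKLRegimeEngineV8TowerCEDefsC
import Summits.HubbardSuperconductivity.HubbardSuperconductivity.Theorems.KLProgrammeKLRegimeEngineV8TowerGeneric
import Summits.HubbardSuperconductivity.HubbardSuperconductivity.Theorems.KLProgrammeKLRegimeEngineV8DefsQ9c
import Summits.HubbardSuperconductivity.HubbardSuperconductivity.Theorems.KLProgrammeKLRegimeEngineV8DefsG11
import Summits.HubbardSuperconductivity.HubbardSuperconductivity.Theorems.KLProgrammeKLRegimeSplitFlowPieceOscDefs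
import Summits.HubbardSuperconductivity.HubbardSuperconductivity.Theorems.KLProgrammeKLRegimeTwoLegReadOscConsts

/-!
# K3 ENGINE (stmt-HubbardSuperconductivity-20437 `KLRegimeEngineV17F2`), stub (b) v2 (ℓ): the ATOM-FREE CORE tower package WITH the c-slot, STATED ON THE
# FROZEN STUB'S OWN BINDER LIST (geometry slot `G`, the (K5′) mean-free history clause), uncapped (§2) and CAPPED under token #13's `e_T` (§3–§4)
# (AMENDMENT 23 «(ℓ)-C-SLOT», pen (R202)/(R203), CONDITIONAL; registrant joint notes (J3)/(J4) p1b g15 + (J5) GEO-JOINT k3c2-p3 g12 + (J6) OSC-HISTORY p1b g15, 2026-08-28)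

WHY.  `…EngineV8TowerCEDefsC` (D1, p637964) defers the c-slotted FULL deliverable `TowerNormsStepC` at `klEngQ8 P R`.  Four joints with the FROZEN image
(rev 14 8d6526fd493cf88b, render b755cc8a5feed069; stub (b) = `stub_engine_step_norms`) are not served by D1 alone:
(J3) CE — the closer concludes AT token #13 `Q := klEngQ9c P R`, `(klEngQ9c P R).CE = klEngQ9cCE P R = max (klEngQ8 P R).CE (klTowerCoreCE P R)`; a package row is usable
there only with `CE ≤ (klEngQ9c P R).CE`, which no row gives for a fresh `Classical.choose` constant ⇒ CAP the package's constant at `klEngQ9cCE P R`;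
(J4) atom — under (R174) the stub's conjunct 5 comes from `…GridLiteralsPkg`'s own producer, so the tower owes only the atom-free CORE (levels ∧ first moments);
(J5) geometry — every tower statement in the tree keys the public history at `klEngGeo8`, the frozen stub binds `HistP klPredsV17F2 L M klEngGeo11 P (klEngQ9c P R) …`
and concludes `EngineFirstMoments L M klEngGeo11 …`; the history is upward-monotone in the geometry, never conversely ⇒ state the core with a GEOMETRY SLOT `G` and
defer at `G := klEngGeo11`;
(J6) osc-history — the (ℓ)/(I1′) suppliers the levels proof composes (`klWtPinnedSumAt_klTowerIncr_le_klEng_all`, …) consume the stub's registered (K5′) clause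
`∀ m, 1 ≤ m → m < n → FlowPieceOscAt L M (klReadOscC P R) β U μ m`, which no tower statement in the tree carries ⇒ the statements below carry it, VERBATIM from the stub,
right after `HistP` (a holder of the osc-free statements loses nothing: `.toV2` bridges drop the binder).
* §1 **`TowerLevelsStepV2 G P R Q₀ CE u cT`** (D1 §3's `TowerLevelsStepC` with `HistP … G …` and the (K5′) clause), **`TowerFirstMomentsStepV2 G P R Q₀ CE u`**
  (…TowerParts' `TowerFirstMomentsStep` likewise, conclusion `EngineFirstMoments L M G P Q …`), **`TowerCoreStepV2 G … CE u cT`** := both; bridges `TowerLevelsStepC.toV2`,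
  `TowerFirstMomentsStep.toV2`, `TowerCoreStep.toV2` (at `klEngGeo8`); `.mono`; the first-moments part from W3's class-#4 witness at ANY well-formed `G` with `klE4TF ≤ G.cE4`
  (`towerFirstMomentsStepV2_of_e4Pack`, via the G-generic `engineFirstMoments_flow_of_e4FlowAt`); `exists_towerCorePkgV2_of_levels_e4(_capped)` (SAME constant + c-threshold).
* §2 the UNCAPPED deferred package at the token's keys `(klEngGeo11, klEngQ8 P R)`: **`klTowerCorePkgC P R`**, **`klTowerCoreCEC / klTowerCoreUC / klTowerCoreCC`** + rows —
  its constant is what a token-#13 successor `e_T ⊔ klTowerCoreCEC` would absorb (an IMAGE motion; pen's option (α1)).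
* §3 the package **CAPPED under the frozen token**: **`klTowerCorePkgC9 P R`** over `∃ e, IsTowerPkgC e ∧ e.1 ≤ klEngQ9cCE P R ∧ TowerCoreStepV2 klEngGeo11 P R (klEngQ8 P R) e.1 e.2.1 e.2.2`
  (default `(klTowerCoreCE P R, 1, 1)`), **`klTowerCoreCEC9 / klTowerCoreUC9 / klTowerCoreCC9`**, UNCONDITIONAL rows `klTowerCoreCEC9_le_klEngQ9c_CE`, `klTowerCoreUC9_pos`,
  `klTowerCoreCC9_pos` (c-chain entry `⊓ klTowerCoreCC9 P R`, u-chain entry `⊓ klTowerCoreUC9 P R (klEngQ9c P R) cc`), `choose_spec` rows.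
* §4 **`towerCoreC9_at_klEngQ9c`** — THE CLOSER-FACING ROW ON THE STUB'S OWN BINDERS: from the capped ∃-statement and stub (b)'s binders (`c ≤ klTowerCoreCC9` via the
  c-chain row, `U ≤ klTowerCoreUC9 … (klEngQ9c P R) c` via the u-chain row, the history AT `klEngGeo11`/`klEngQ9c`, the (K5′) clause, `FrameOK`, the class-#1 exports) the
  levels bundle at every `1 ≤ j ≤ n` AND `EngineFirstMoments L M klEngGeo11 P (klEngQ9c P R) … n` = stub (b)'s conjuncts 2 (j ≥ 1) and 3 VERBATIM.  Zero image tokens.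
HONEST LABEL: the producer's constant is capped at `e_T`; lifting the cap is a token-#13 motion.  Definitions with bodies + bookkeeping rows; the producer statements are
HYPOTHESIS slots; nothing about the model is asserted; nothing asserts (b), (ℓ), any stub of 20437, K3 or superconductivity.
-/

noncomputable section

namespace Summit.HubbardSuperconductivity.HubbardSuperconductivity.Theorems.EngineV8

set_option linter.dupNamespace false -- summit = problem name (single-conjunct summit), D-0017

open Real Finset Literature.MathematicalPhysics.QuantumLattice Literature.Probability.LatticeModels
open Literature.MathematicalPhysics.QuantumLattice.FermiRG
open Summit.HubbardSuperconductivity.HubbardSuperconductivity.Theorems.KLRegimeSplit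
open Summit.HubbardSuperconductivity.HubbardSuperconductivity.Theorems.KLProgrammeLegKernels
open Summit.HubbardSuperconductivity.HubbardSuperconductivity.Theorems.DispersionFlow

/-! ## §1 The atom-free core with the c-slot, on the stub's binder list -/

/-- **`TowerLevelsStepV2 G P R Q₀ CE u cT`** — the c-slotted LEVELS part (D1 §3 `TowerLevelsStepC`) with the public history keyed at the geometry slot `G` and the
stub's registered (K5′) mean-free clause `∀ m, 1 ≤ m → m < n → FlowPieceOscAt L M (klReadOscC P R) β U μ m` right after it; conclusion verbatim (G-free):
at every tower level `1 ≤ j ≤ n`, `KernelNormsLevels … (K_n) j ∧ KernelNormsWt4 (klWtBudget P Q U j) … (K_n) j`. -/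
def TowerLevelsStepV2 (G : GeoConsts) (P : SplitConsts) (R : RenConsts) (Q₀ : EngConsts) (CE : ℝ) (u : EngConsts → ℝ → ℝ) (cT : ℝ) : Prop :=
  ∀ Q : EngConsts, Q₀.IsRaiseOf Q → CE ≤ Q.CE →
    ∀ cc : ℝ, 0 < cc → cc ≤ klEngC₃6 P R → cc ≤ cT →
      ∀ μ ∈ klWindowC, ∀ U : ℝ, 0 < U → U ≤ klEngU₀10 P R cc → U ≤ u Q cc →
        ∀ β : ℝ, klBetaMin ≤ β → β ≤ Real.exp (cc / U ^ 2) →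
          ∀ (L M : ℕ) [NeZero L] [NeZero M], klEngL₄ P R β U ≤ L → klEngM₃ β U L ≤ M →
            ∀ n : ℕ, 1 ≤ n → n ≤ nScales β + 1 → IsKLRegime U cc (-(n : ℤ)) →
              HistP klPredsV17F2 L M G P Q R β U μ 0 n →
                (∀ m, 1 ≤ m → m < n → FlowPieceOscAt L M (klReadOscC P R) β U μ m) →
                  FrameOK R U (nScales β) μ (klFlowFrameU L M β U μ n) →
                    (∀ j ≤ n, LevelsUExportMixedAt L M (klCU2 P R (klEngQ7 P R)) P β U μ j) →
                      ∀ j : ℕ, 1 ≤ j → j ≤ n →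
                        KernelNormsLevels L M P Q β U μ (klFlowFrameU L M β U μ n) j ∧
                          KernelNormsWt4 L M (klWtBudget P Q U j) β U μ (klFlowFrameU L M β U μ n) j

/-- **`TowerFirstMomentsStepV2 G P R Q₀ CE u`** — the FIRST-MOMENTS part (…TowerParts `TowerFirstMomentsStep`) with the history keyed at `G`, the (K5′) clause (unused by
its E4 supplier, carried so that both parts share stub (b)'s binder list), and conclusion `EngineFirstMoments L M G P Q β U μ (K_n) n`. -/
def TowerFirstMomentsStepV2 (G : GeoConsts) (P : SplitConsts) (R : RenConsts) (Q₀ : EngConsts) (CE : ℝ) (u : EngConsts → ℝ → ℝ) : Prop :=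
  ∀ Q : EngConsts, Q₀.IsRaiseOf Q → CE ≤ Q.CE →
    ∀ cc : ℝ, 0 < cc → cc ≤ klEngC₃6 P R →
      ∀ μ ∈ klWindowC, ∀ U : ℝ, 0 < U → U ≤ klEngU₀10 P R cc → U ≤ u Q cc →
        ∀ β : ℝ, klBetaMin ≤ β → β ≤ Real.exp (cc / U ^ 2) →
          ∀ (L M : ℕ) [NeZero L] [NeZero M], klEngL₄ P R β U ≤ L → klEngM₃ β U L ≤ M →
            ∀ n : ℕ, 1 ≤ n → n ≤ nScales β + 1 → IsKLRegime U cc (-(n : ℤ)) →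
              HistP klPredsV17F2 L M G P Q R β U μ 0 n →
                (∀ m, 1 ≤ m → m < n → FlowPieceOscAt L M (klReadOscC P R) β U μ m) →
                  FrameOK R U (nScales β) μ (klFlowFrameU L M β U μ n) →
                    (∀ j ≤ n, LevelsUExportMixedAt L M (klCU2 P R (klEngQ7 P R)) P β U μ j) →
                      EngineFirstMoments L M G P Q β U μ (klFlowFrameU L M β U μ n) n

/-- **`TowerCoreStepV2 G P R Q₀ CE u cT`** — the ATOM-FREE CORE with the c-slot on the stub's binder list: levels ∧ first moments. -/
def TowerCoreStepV2 (G : GeoConsts) (P : SplitConsts) (R : RenConsts) (Q₀ : EngConsts) (CE : ℝ) (u : EngConsts → ℝ → ℝ) (cT : ℝ) : Prop :=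
  TowerLevelsStepV2 G P R Q₀ CE u cT ∧ TowerFirstMomentsStepV2 G P R Q₀ CE u

section Core

variable {G : GeoConsts} {P : SplitConsts} {R : RenConsts} {Q₀ : EngConsts} {CE CE' : ℝ} {u u' : EngConsts → ℝ → ℝ} {cT cT' : ℝ}

/-- D1's `TowerLevelsStepC` (history at `klEngGeo8`, no osc clause) implies the V2 statement at `klEngGeo8` (the osc clause is simply not used). -/
theorem TowerLevelsStepC.toV2 (h : TowerLevelsStepC P R Q₀ CE u cT) : TowerLevelsStepV2 klEngGeo8 P R Q₀ CE u cT :=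
  fun Q hQ hCE cc hcc hcc6 hccT μ hμ U hU hU10 hUu β hβ hβc L M _ _ hL hM n hn1 hn hreg hhist _ hfr hlevU =>
    h Q hQ hCE cc hcc hcc6 hccT μ hμ U hU hU10 hUu β hβ hβc L M hL hM n hn1 hn hreg hhist hfr hlevU

/-- …TowerParts' `TowerFirstMomentsStep` implies the V2 statement at `klEngGeo8`. -/
theorem TowerFirstMomentsStep.toV2 (h : TowerFirstMomentsStep P R Q₀ CE u) : TowerFirstMomentsStepV2 klEngGeo8 P R Q₀ CE u :=
  fun Q hQ hCE cc hcc hcc6 μ hμ U hU hU10 hUu β hβ hβc L M _ _ hL hM n hn1 hn hreg hhist _ hfr hlevU =>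
    h Q hQ hCE cc hcc hcc6 μ hμ U hU hU10 hUu β hβ hβc L M hL hM n hn1 hn hreg hhist hfr hlevU

/-- …TowerGeneric's c-free, osc-free core implies the V2 core at `klEngGeo8` for every threshold `cT`. -/
theorem TowerCoreStep.toV2 (h : TowerCoreStep P R Q₀ CE u) (cT : ℝ) : TowerCoreStepV2 klEngGeo8 P R Q₀ CE u cT :=
  ⟨(h.1.toC cT).toV2, h.2.toV2⟩

/-- `TowerLevelsStepV2` is monotone in `CE`, antitone in `u` and in `cT`. -/
theorem TowerLevelsStepV2.mono (h : TowerLevelsStepV2 G P R Q₀ CE u cT) (hCE : CE ≤ CE') (hu : ∀ Q cc, u' Q cc ≤ u Q cc) (hc : cT' ≤ cT) :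
    TowerLevelsStepV2 G P R Q₀ CE' u' cT' :=
  fun Q hQ hCE' cc hcc hcc6 hccT μ hμ U hU hU10 hUu =>
    h Q hQ (hCE.trans hCE') cc hcc hcc6 (hccT.trans hc) μ hμ U hU hU10 (hUu.trans (hu Q cc))

/-- `TowerFirstMomentsStepV2` is monotone in `CE` and antitone in `u`. -/
theorem TowerFirstMomentsStepV2.mono (h : TowerFirstMomentsStepV2 G P R Q₀ CE u) (hCE : CE ≤ CE') (hu : ∀ Q cc, u' Q cc ≤ u Q cc) :
    TowerFirstMomentsStepV2 G P R Q₀ CE' u' :=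
  fun Q hQ hCE' cc hcc hcc6 μ hμ U hU hU10 hUu =>
    h Q hQ (hCE.trans hCE') cc hcc hcc6 μ hμ U hU hU10 (hUu.trans (hu Q cc))

/-- `TowerCoreStepV2` is monotone in `CE`, antitone in `u` and in `cT`. -/
theorem TowerCoreStepV2.mono (h : TowerCoreStepV2 G P R Q₀ CE u cT) (hCE : CE ≤ CE') (hu : ∀ Q cc, u' Q cc ≤ u Q cc) (hc : cT' ≤ cT) :
    TowerCoreStepV2 G P R Q₀ CE' u' cT' :=
  ⟨h.1.mono hCE hu hc, h.2.mono hCE hu⟩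

/-- **The first-moments part from W3's class-#4 witness at ANY well-formed geometry with `klE4TF ≤ G.cE4`** (twin of …TowerParts `towerFirstMomentsStep_of_e4Pack` through
the G-generic `engineFirstMoments_flow_of_e4FlowAt`): every `CE`, threshold `klE4UF G P R`. -/
theorem towerFirstMomentsStepV2_of_e4Pack (G : GeoConsts) (hG : G.WF) (hcE4 : klE4TF ≤ G.cE4) (hP : P.WF) (hR : R.WF2) (hQ₀ : (klEngQ7 P R).IsRaiseOf Q₀)
    (hE : ∃ Eu : ℝ × (GeoConsts → SplitConsts → RenConsts → EngConsts → ℝ → ℝ),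
      0 ≤ Eu.1 ∧ (∀ G P R Q cc, 0 < Eu.2 G P R Q cc) ∧ E4FlowAt Eu.1 Eu.2) (CE : ℝ) :
    TowerFirstMomentsStepV2 G P R Q₀ CE (fun Q cc => klE4UF G P R Q cc) := by
  obtain ⟨⟨E, u'⟩, hE0, hu', hE⟩ := hE
  intro Q hQ _ cc hcc hcc6 μ hμ U hU _ hUu β hβ hβc L M _ _ hL hM n hn1 hn hreg hhist _ hfr _
  exact engineFirstMoments_flow_of_e4FlowAt hE0 hu' hE G hG hcE4 P R Q cc hP hR ((hQ₀.trans hQ).wf (klEngQ7_wf P R)) hcc hcc6 μ hμ U hU hUu β hβ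
    hβc L M (klEngL₃_le_of_klEngL₄_le hL) hM n hn1 hn hreg hhist hfr

/-- **V2 core package from a V2 levels package and the class-#4 witness** (SAME constant and c-threshold; threshold `uℓ ⊓ klE4UF G P R`). -/
theorem exists_towerCorePkgV2_of_levels_e4 (G : GeoConsts) (hG : G.WF) (hcE4 : klE4TF ≤ G.cE4) (hP : P.WF) (hR : R.WF2) (hQ₀ : (klEngQ7 P R).IsRaiseOf Q₀)
    (hℓ : ∃ e : ℝ × (EngConsts → ℝ → ℝ) × ℝ, IsTowerPkgC e ∧ TowerLevelsStepV2 G P R Q₀ e.1 e.2.1 e.2.2)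
    (hE : ∃ Eu : ℝ × (GeoConsts → SplitConsts → RenConsts → EngConsts → ℝ → ℝ),
      0 ≤ Eu.1 ∧ (∀ G P R Q cc, 0 < Eu.2 G P R Q cc) ∧ E4FlowAt Eu.1 Eu.2) :
    ∃ e : ℝ × (EngConsts → ℝ → ℝ) × ℝ, IsTowerPkgC e ∧ TowerCoreStepV2 G P R Q₀ e.1 e.2.1 e.2.2 := by
  obtain ⟨⟨CEℓ, uℓ, c⟩, ⟨hℓ0, hℓu, hℓc⟩, hℓ⟩ := hℓ
  refine ⟨(CEℓ, fun Q cc => min (uℓ Q cc) (klE4UF G P R Q cc), c),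
    ⟨hℓ0, fun Q cc => lt_min (hℓu Q cc) (klE4UF_pos G P R Q cc), hℓc⟩, ?_, ?_⟩
  · exact hℓ.mono le_rfl (fun Q cc => min_le_left _ _) le_rfl
  · exact (towerFirstMomentsStepV2_of_e4Pack G hG hcE4 hP hR hQ₀ hE CEℓ).mono le_rfl fun Q cc => min_le_right _ _

/-- **Capped twin**: a cap `e.1 ≤ B` on the levels package's constant is inherited (same constant). -/
theorem exists_towerCorePkgV2_of_levels_e4_capped {B : ℝ} (G : GeoConsts) (hG : G.WF) (hcE4 : klE4TF ≤ G.cE4) (hP : P.WF) (hR : R.WF2)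
    (hQ₀ : (klEngQ7 P R).IsRaiseOf Q₀)
    (hℓ : ∃ e : ℝ × (EngConsts → ℝ → ℝ) × ℝ, IsTowerPkgC e ∧ e.1 ≤ B ∧ TowerLevelsStepV2 G P R Q₀ e.1 e.2.1 e.2.2)
    (hE : ∃ Eu : ℝ × (GeoConsts → SplitConsts → RenConsts → EngConsts → ℝ → ℝ),
      0 ≤ Eu.1 ∧ (∀ G P R Q cc, 0 < Eu.2 G P R Q cc) ∧ E4FlowAt Eu.1 Eu.2) :
    ∃ e : ℝ × (EngConsts → ℝ → ℝ) × ℝ, IsTowerPkgC e ∧ e.1 ≤ B ∧ TowerCoreStepV2 G P R Q₀ e.1 e.2.1 e.2.2 := by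
  obtain ⟨⟨CEℓ, uℓ, c⟩, ⟨hℓ0, hℓu, hℓc⟩, hB, hℓ⟩ := hℓ
  refine ⟨(CEℓ, fun Q cc => min (uℓ Q cc) (klE4UF G P R Q cc), c),
    ⟨hℓ0, fun Q cc => lt_min (hℓu Q cc) (klE4UF_pos G P R Q cc), hℓc⟩, hB, ?_, ?_⟩
  · exact hℓ.mono le_rfl (fun Q cc => min_le_left _ _) le_rfl
  · exact (towerFirstMomentsStepV2_of_e4Pack G hG hcE4 hP hR hQ₀ hE CEℓ).mono le_rfl fun Q cc => min_le_right _ _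

end Core

/-! ## §2 The UNCAPPED deferred core package at the token's keys `(klEngGeo11, klEngQ8 P R)` (constant for a token-#13 successor) -/

section Deferred

variable (P : SplitConsts) (R : RenConsts)

/-- **`klTowerCorePkgC P R`**: SOME admissible `(CE, u, cT)` with `TowerCoreStepV2 klEngGeo11 P R (klEngQ8 P R) CE u cT`, if one exists, ELSE the default
`(klTowerCoreCE P R, fun _ _ => 1, 1)` (admissible in both branches). -/
def klTowerCorePkgC : ℝ × (EngConsts → ℝ → ℝ) × ℝ :=
  open scoped Classical in
  if h : ∃ e : ℝ × (EngConsts → ℝ → ℝ) × ℝ, IsTowerPkgC e ∧ TowerCoreStepV2 klEngGeo11 P R (klEngQ8 P R) e.1 e.2.1 e.2.2 then Classical.choose h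
  else (klTowerCoreCE P R, fun _ _ => 1, 1)

/-- **The uncapped core-C constant** `klTowerCoreCEC P R := (klTowerCorePkgC P R).1`. -/
def klTowerCoreCEC : ℝ := (klTowerCorePkgC P R).1

/-- **The uncapped core-C coupling threshold** `klTowerCoreUC P R := (klTowerCorePkgC P R).2.1`. -/
def klTowerCoreUC : EngConsts → ℝ → ℝ := (klTowerCorePkgC P R).2.1

/-- **The uncapped core-C regime-constant threshold** `klTowerCoreCC P R := (klTowerCorePkgC P R).2.2`. -/
def klTowerCoreCC : ℝ := (klTowerCorePkgC P R).2.2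

/-- The deferred core-C package is admissible (unconditionally). -/
theorem isTowerPkgC_klTowerCorePkgC : IsTowerPkgC (klTowerCorePkgC P R) := by
  classical
  unfold klTowerCorePkgC
  split_ifs with h
  · exact (Classical.choose_spec h).1
  · exact ⟨klTowerCoreCE_nonneg P R, fun _ _ => one_pos, one_pos⟩

/-- `0 ≤ klTowerCoreCEC P R`. -/
theorem klTowerCoreCEC_nonneg : 0 ≤ klTowerCoreCEC P R := (isTowerPkgC_klTowerCorePkgC P R).1

/-- `0 < klTowerCoreUC P R Q cc`. -/
theorem klTowerCoreUC_pos (Q : EngConsts) (cc : ℝ) : 0 < klTowerCoreUC P R Q cc := (isTowerPkgC_klTowerCorePkgC P R).2.1 Q cc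

/-- `0 < klTowerCoreCC P R`. -/
theorem klTowerCoreCC_pos : 0 < klTowerCoreCC P R := (isTowerPkgC_klTowerCorePkgC P R).2.2

variable {P R}

/-- The V2 core holds for the deferred package as soon as it holds for some admissible package (`choose_spec`). -/
theorem towerCoreStepV2_klTowerCoreC_of_exists
    (h : ∃ e : ℝ × (EngConsts → ℝ → ℝ) × ℝ, IsTowerPkgC e ∧ TowerCoreStepV2 klEngGeo11 P R (klEngQ8 P R) e.1 e.2.1 e.2.2) :
    TowerCoreStepV2 klEngGeo11 P R (klEngQ8 P R) (klTowerCoreCEC P R) (klTowerCoreUC P R) (klTowerCoreCC P R) := by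
  classical
  have hpkg : klTowerCorePkgC P R = Classical.choose h := by
    unfold klTowerCorePkgC
    rw [dif_pos h]
  unfold klTowerCoreCEC klTowerCoreUC klTowerCoreCC
  rw [hpkg]
  exact (Classical.choose_spec h).2

/-- Packaging an explicit witness `(CE, u, cT)`. -/
theorem towerCoreStepV2_klTowerCoreC_of {CE : ℝ} {u : EngConsts → ℝ → ℝ} {cT : ℝ} (hCE : 0 ≤ CE) (hu : ∀ Q cc, 0 < u Q cc) (hcT : 0 < cT)
    (hs : TowerCoreStepV2 klEngGeo11 P R (klEngQ8 P R) CE u cT) :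
    TowerCoreStepV2 klEngGeo11 P R (klEngQ8 P R) (klTowerCoreCEC P R) (klTowerCoreUC P R) (klTowerCoreCC P R) :=
  towerCoreStepV2_klTowerCoreC_of_exists ⟨(CE, u, cT), ⟨hCE, hu, hcT⟩, hs⟩

/-- ELSE branch: with no admissible witness the deferred package IS the default. -/
theorem klTowerCorePkgC_of_not_exists
    (h : ¬ ∃ e : ℝ × (EngConsts → ℝ → ℝ) × ℝ, IsTowerPkgC e ∧ TowerCoreStepV2 klEngGeo11 P R (klEngQ8 P R) e.1 e.2.1 e.2.2) :
    klTowerCorePkgC P R = (klTowerCoreCE P R, fun _ _ => 1, 1) := by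
  classical
  unfold klTowerCorePkgC
  rw [dif_neg h]

end Deferred

/-! ## §3 The core package CAPPED under the frozen token #13's `e_T = klEngQ9cCE P R` -/

section Capped

variable (P : SplitConsts) (R : RenConsts)

/-- **`klTowerCorePkgC9 P R`**: SOME admissible `(CE, u, cT)` with `CE ≤ klEngQ9cCE P R` and `TowerCoreStepV2 klEngGeo11 P R (klEngQ8 P R) CE u cT`, if one exists,
ELSE `(klTowerCoreCE P R, fun _ _ => 1, 1)` — in BOTH branches the constant sits under token #13's `e_T` (`klTowerCoreCE ≤ klEngQ9cCE`, …DefsQ9c). -/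
def klTowerCorePkgC9 : ℝ × (EngConsts → ℝ → ℝ) × ℝ :=
  open scoped Classical in
  if h : ∃ e : ℝ × (EngConsts → ℝ → ℝ) × ℝ, IsTowerPkgC e ∧ e.1 ≤ klEngQ9cCE P R ∧ TowerCoreStepV2 klEngGeo11 P R (klEngQ8 P R) e.1 e.2.1 e.2.2
  then Classical.choose h else (klTowerCoreCE P R, fun _ _ => 1, 1)

/-- **The capped core-C constant** `klTowerCoreCEC9 P R := (klTowerCorePkgC9 P R).1`. -/
def klTowerCoreCEC9 : ℝ := (klTowerCorePkgC9 P R).1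

/-- **The capped core-C coupling threshold** `klTowerCoreUC9 P R := (klTowerCorePkgC9 P R).2.1` (u-chain entry `⊓ klTowerCoreUC9 P R (klEngQ9c P R) cc`). -/
def klTowerCoreUC9 : EngConsts → ℝ → ℝ := (klTowerCorePkgC9 P R).2.1

/-- **The capped core-C regime-constant threshold** `klTowerCoreCC9 P R := (klTowerCorePkgC9 P R).2.2` (c-chain entry `⊓ klTowerCoreCC9 P R`). -/
def klTowerCoreCC9 : ℝ := (klTowerCorePkgC9 P R).2.2

/-- The capped package is admissible AND capped (unconditionally): `IsTowerPkgC ∧ constant ≤ klEngQ9cCE P R`. -/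
theorem isTowerPkgC_klTowerCorePkgC9_and_le : IsTowerPkgC (klTowerCorePkgC9 P R) ∧ (klTowerCorePkgC9 P R).1 ≤ klEngQ9cCE P R := by
  classical
  unfold klTowerCorePkgC9
  split_ifs with h
  · exact ⟨(Classical.choose_spec h).1, (Classical.choose_spec h).2.1⟩
  · exact ⟨⟨klTowerCoreCE_nonneg P R, fun _ _ => one_pos, one_pos⟩, klTowerCoreCE_le_klEngQ9cCE P R⟩

/-- `0 ≤ klTowerCoreCEC9 P R`. -/
theorem klTowerCoreCEC9_nonneg : 0 ≤ klTowerCoreCEC9 P R := (isTowerPkgC_klTowerCorePkgC9_and_le P R).1.1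

/-- **THE CE-JOINT ROW**: `klTowerCoreCEC9 P R ≤ (klEngQ9c P R).CE` (unconditionally) — what the stub-(b) closer feeds as `CE ≤ Q.CE` at token #13. -/
theorem klTowerCoreCEC9_le_klEngQ9c_CE : klTowerCoreCEC9 P R ≤ (klEngQ9c P R).CE := by
  rw [klEngQ9c_CE_eq]; exact (isTowerPkgC_klTowerCorePkgC9_and_le P R).2

/-- `0 < klTowerCoreUC9 P R Q cc` (unconditionally). -/
theorem klTowerCoreUC9_pos (Q : EngConsts) (cc : ℝ) : 0 < klTowerCoreUC9 P R Q cc := (isTowerPkgC_klTowerCorePkgC9_and_le P R).1.2.1 Q cc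

/-- `0 < klTowerCoreCC9 P R` (unconditionally). -/
theorem klTowerCoreCC9_pos : 0 < klTowerCoreCC9 P R := (isTowerPkgC_klTowerCorePkgC9_and_le P R).1.2.2

variable {P R}

/-- The V2 core holds for the capped package as soon as some admissible CAPPED witness exists (`choose_spec`). -/
theorem towerCoreStepV2_klTowerCoreC9_of_exists
    (h : ∃ e : ℝ × (EngConsts → ℝ → ℝ) × ℝ, IsTowerPkgC e ∧ e.1 ≤ klEngQ9cCE P R ∧ TowerCoreStepV2 klEngGeo11 P R (klEngQ8 P R) e.1 e.2.1 e.2.2) :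
    TowerCoreStepV2 klEngGeo11 P R (klEngQ8 P R) (klTowerCoreCEC9 P R) (klTowerCoreUC9 P R) (klTowerCoreCC9 P R) := by
  classical
  have hpkg : klTowerCorePkgC9 P R = Classical.choose h := by
    unfold klTowerCorePkgC9
    rw [dif_pos h]
  unfold klTowerCoreCEC9 klTowerCoreUC9 klTowerCoreCC9
  rw [hpkg]
  exact (Classical.choose_spec h).2.2

/-- Packaging an explicit CAPPED witness `(CE, u, cT)`, `CE ≤ klEngQ9cCE P R` (e.g. any `CE ≤ (klEngQ8 P R).CE`, via `klEngQ8_CE_le_klEngQ9cCE`). -/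
theorem towerCoreStepV2_klTowerCoreC9_of {CE : ℝ} {u : EngConsts → ℝ → ℝ} {cT : ℝ} (hCE : 0 ≤ CE) (hcap : CE ≤ klEngQ9cCE P R)
    (hu : ∀ Q cc, 0 < u Q cc) (hcT : 0 < cT) (hs : TowerCoreStepV2 klEngGeo11 P R (klEngQ8 P R) CE u cT) :
    TowerCoreStepV2 klEngGeo11 P R (klEngQ8 P R) (klTowerCoreCEC9 P R) (klTowerCoreUC9 P R) (klTowerCoreCC9 P R) :=
  towerCoreStepV2_klTowerCoreC9_of_exists ⟨(CE, u, cT), ⟨hCE, hu, hcT⟩, hcap, hs⟩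

/-- ELSE branch: with no admissible capped witness the capped package IS the default. -/
theorem klTowerCorePkgC9_of_not_exists
    (h : ¬ ∃ e : ℝ × (EngConsts → ℝ → ℝ) × ℝ, IsTowerPkgC e ∧ e.1 ≤ klEngQ9cCE P R ∧ TowerCoreStepV2 klEngGeo11 P R (klEngQ8 P R) e.1 e.2.1 e.2.2) :
    klTowerCorePkgC9 P R = (klTowerCoreCE P R, fun _ _ => 1, 1) := by
  classical
  unfold klTowerCorePkgC9
  rw [dif_neg h]

end Capped

/-! ## §4 The closer-facing row at the frozen token `klEngQ9c P R` / `klEngGeo11`, on stub (b)'s own binders -/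

/-- **THE CE-, GEO- AND OSC-JOINTS CLOSE BY NAME (zero image tokens).**  From the capped core ∃-statement and stub (b)'s binders — `0 < c ≤ klEngC₃6 P R`,
`c ≤ klTowerCoreCC9 P R` (c-chain row), `U ≤ klEngU₀10 P R c`, `U ≤ klTowerCoreUC9 P R (klEngQ9c P R) c` (u-chain row), the v2 doors, `1 ≤ n ≤ n_β + 1`, the regime,
the public history AT `klEngGeo11` / `klEngQ9c P R`, the registered (K5′) mean-free clause, `K_n` admissible, the class-#1 exports — the levels bundle at every `1 ≤ j ≤ n`
and `EngineFirstMoments` at `K_n`, both AT `klEngGeo11` / `klEngQ9c P R`, i.e. stub (b)'s conjuncts 2 (levels `j ≥ 1`) and 3 verbatim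
(`isRaiseOf_klEngQ9c_klEngQ8`, `klTowerCoreCEC9_le_klEngQ9c_CE`). -/
theorem towerCoreC9_at_klEngQ9c {P : SplitConsts} {R : RenConsts}
    (hex : ∃ e : ℝ × (EngConsts → ℝ → ℝ) × ℝ, IsTowerPkgC e ∧ e.1 ≤ klEngQ9cCE P R ∧ TowerCoreStepV2 klEngGeo11 P R (klEngQ8 P R) e.1 e.2.1 e.2.2)
    {c μ U β : ℝ} {L M : ℕ} [NeZero L] [NeZero M] {n : ℕ}
    (hc : 0 < c) (hc36 : c ≤ klEngC₃6 P R) (hcT : c ≤ klTowerCoreCC9 P R) (hμ : μ ∈ klWindowC) (hU : 0 < U) (hU10 : U ≤ klEngU₀10 P R c)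
    (hUu : U ≤ klTowerCoreUC9 P R (klEngQ9c P R) c) (hβ : klBetaMin ≤ β) (hβc : β ≤ Real.exp (c / U ^ 2))
    (hL : klEngL₄ P R β U ≤ L) (hM : klEngM₃ β U L ≤ M) (hn1 : 1 ≤ n) (hn : n ≤ nScales β + 1) (hreg : IsKLRegime U c (-(n : ℤ)))
    (hhist : HistP klPredsV17F2 L M klEngGeo11 P (klEngQ9c P R) R β U μ 0 n)
    (hosc : ∀ m, 1 ≤ m → m < n → FlowPieceOscAt L M (klReadOscC P R) β U μ m)
    (hfr : FrameOK R U (nScales β) μ (klFlowFrameU L M β U μ n))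
    (hlevU : ∀ j ≤ n, LevelsUExportMixedAt L M (klCU2 P R (klEngQ7 P R)) P β U μ j) :
    (∀ j : ℕ, 1 ≤ j → j ≤ n →
      KernelNormsLevels L M P (klEngQ9c P R) β U μ (klFlowFrameU L M β U μ n) j ∧
        KernelNormsWt4 L M (klWtBudget P (klEngQ9c P R) U j) β U μ (klFlowFrameU L M β U μ n) j) ∧
    EngineFirstMoments L M klEngGeo11 P (klEngQ9c P R) β U μ (klFlowFrameU L M β U μ n) n := by
  have h := towerCoreStepV2_klTowerCoreC9_of_exists hex
  exact ⟨h.1 (klEngQ9c P R) (isRaiseOf_klEngQ9c_klEngQ8 P R) (klTowerCoreCEC9_le_klEngQ9c_CE P R) c hc hc36 hcT μ hμ U hU hU10 hUu β hβ hβc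
      L M hL hM n hn1 hn hreg hhist hosc hfr hlevU,
    h.2 (klEngQ9c P R) (isRaiseOf_klEngQ9c_klEngQ8 P R) (klTowerCoreCEC9_le_klEngQ9c_CE P R) c hc hc36 μ hμ U hU hU10 hUu β hβ hβc
      L M hL hM n hn1 hn hreg hhist hosc hfr hlevU⟩

end Summit.HubbardSuperconductivity.HubbardSuperconductivity.Theorems.EngineV8

end
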